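import Summits.NavierStokesRegularity.NavierStokesRegularity.Theses.AxisymmetricExtremality
import Summits.NavierStokesRegularity.NavierStokesRegularity.Theorems.AxisymmetricExtremalityAxisymmetricKatoGlobalNoSwirlStratum
import Literature.Analysis.FluidPDE.KNSSLiouville
import HarnessLib

/-!
# Strategist s17-g5 sketch for crux `AxisymmetricKatoGlobal` (stmt-NavierStokesRegularity-15453)

Kernel-checked content behind `STRATEGY-CENSUS-s17-g5.md` (independent census, family `s`).

* §1 `hasNoSwirl_of_isAxisymmetric_of_isMirrorSymmetric` — an axisymmetric field that is also
  equivariant under the VERTICAL mirror `σ_v (x₀,x₁,x₂) = (x₀,−x₁,x₂)` is swirl-free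
  (`Γ(σ_v x) = −Γ(x)` and `Γ` is rotation invariant, so `Γ ≡ 0`).
* §2 ROUTE-LEVEL BYPASS (recommendation R1, not filed — this seat may not edit `closes`): if crux #2
  `MinimalDatumPFold` is posed for the symmetry groups `C_{p v} = ⟨R_{2π/p}, σ_v⟩ ⊂ O(3)` (for
  `p = 2^k` these are 2-groups, so P. A. Smith's fixed-point theorem needs only `F₂`-acyclicity of
  `M̂ = M/Sim`) and the PROVED compactness upgrade `PFoldToAxisymmetric` is re-run carrying `σ_v`
  along, then the deciding theorem needs only the LANDED no-swirl stratum
  `NoSwirlStratum.axisymmetricKatoGlobal_noSwirl_stratum` — `closes_mirror` below — and the open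
  crux `AxisymmetricKatoGlobal` (axisymmetric-with-swirl regularity) leaves the cone.
* §3 W1: the weakest replacement of the crux keeping `closes` verbatim (`NoAxisymMinimalBlowupDatum`),
  with `closes_of_W1` and `W1_of_crux`.
* §4 the only two-sided-open split found (KNSS Liouville bridge), typed, with its trivial seam.
No `sorry`. Nothing here is a route item; decl names are this sketch's own.
-/

namespace Summit.NavierStokesRegularity.NavierStokesRegularity.Cruxes.AxisymmetricKatoGlobal.StrategistS17g5

open MeasureTheory Set
open Literature.Analysis.FluidPDE
open Summit.NavierStokesRegularity.NavierStokesRegularity.Theses.AxisymmetricExtremality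
open Summit.NavierStokesRegularity.NavierStokesRegularity.Theorems.AxisymmetricKatoGlobal

/-! ## §1 Vertical mirror symmetry kills the swirl -/

/-- The vertical mirror `σ_v (x₀,x₁,x₂) = (x₀, −x₁, x₂)`: reflection of `ℝ³` in the plane
`{x₁ = 0}`, which contains the symmetry axis (the `x₂`-axis). An improper element of `O(3)`. -/
def mirrorV (x : EuclideanSpace ℝ (Fin 3)) : EuclideanSpace ℝ (Fin 3) :=
  WithLp.toLp 2 ![x 0, -(x 1), x 2]

@[simp] theorem mirrorV_apply_zero (x : EuclideanSpace ℝ (Fin 3)) : mirrorV x 0 = x 0 := rfl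
@[simp] theorem mirrorV_apply_one (x : EuclideanSpace ℝ (Fin 3)) : mirrorV x 1 = -(x 1) := rfl
@[simp] theorem mirrorV_apply_two (x : EuclideanSpace ℝ (Fin 3)) : mirrorV x 2 = x 2 := rfl

/-- Equivariance of a velocity field under the vertical mirror: `u (σ_v x) = σ_v (u x)`
(velocity is a polar vector, so this is the honest `O(3)`-action; NS and the `Ḣ^{1/2}` norm are
invariant under it, hence so is the Rusin–Šverák set `M`). -/
def IsMirrorSymmetric (u : EuclideanSpace ℝ (Fin 3) → EuclideanSpace ℝ (Fin 3)) : Prop :=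
  ∀ x, u (mirrorV x) = mirrorV (u x)

/-- The swirl `Γ = x₀ u₁ − x₁ u₀` is ODD under the vertical mirror. -/
theorem swirl_mirrorV {u : EuclideanSpace ℝ (Fin 3) → EuclideanSpace ℝ (Fin 3)}
    (h : IsMirrorSymmetric u) (x : EuclideanSpace ℝ (Fin 3)) :
    swirl u (mirrorV x) = -swirl u x := by
  simp only [swirl, h x, mirrorV_apply_zero, mirrorV_apply_one]
  ring

/-- The swirl of an axisymmetric field is rotation invariant. -/
theorem swirl_rotZ {u : EuclideanSpace ℝ (Fin 3) → EuclideanSpace ℝ (Fin 3)}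
    (h : IsAxisymmetric u) (θ : ℝ) (x : EuclideanSpace ℝ (Fin 3)) :
    swirl u (rotZ θ x) = swirl u x := by
  simp only [swirl, h θ x, rotZ_apply_zero, rotZ_apply_one]
  linear_combination (x 0 * u x 1 - x 1 * u x 0) * Real.sin_sq_add_cos_sq θ

/-- A point of the mirror plane `{x₁ = 0}` is fixed by `σ_v`. -/
theorem mirrorV_eq_self {y : EuclideanSpace ℝ (Fin 3)} (hy : y 1 = 0) : mirrorV y = y := by
  ext i
  fin_cases i <;> simp [mirrorV, hy]

/-- **Mirror + axial symmetry ⇒ no swirl.** Rotate `x` into the mirror plane (`R_θ x ∈ {x₁ = 0}`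
for `θ = arg (x₀ − i x₁)`); there `Γ = −Γ`, and `Γ` is rotation invariant. -/
theorem hasNoSwirl_of_isAxisymmetric_of_isMirrorSymmetric
    {u : EuclideanSpace ℝ (Fin 3) → EuclideanSpace ℝ (Fin 3)}
    (hax : IsAxisymmetric u) (hmir : IsMirrorSymmetric u) : HasNoSwirl u := by
  intro x
  by_cases hr : x 0 = 0 ∧ x 1 = 0
  · simp [swirl, hr.1, hr.2]
  · have hz0 : (⟨x 0, -(x 1)⟩ : ℂ) ≠ 0 := by
      intro h
      apply hr
      have h1 := congrArg Complex.re h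
      have h2 := congrArg Complex.im h
      simp at h1 h2
      exact ⟨h1, h2⟩
    set θ : ℝ := Complex.arg (⟨x 0, -(x 1)⟩ : ℂ) with hθ
    have hc : Real.cos θ = x 0 / ‖(⟨x 0, -(x 1)⟩ : ℂ)‖ := Complex.cos_arg hz0
    have hs : Real.sin θ = -(x 1) / ‖(⟨x 0, -(x 1)⟩ : ℂ)‖ := Complex.sin_arg _
    have hy1 : rotZ θ x 1 = 0 := by
      rw [rotZ_apply_one, hc, hs]
      ring
    have hfix : mirrorV (rotZ θ x) = rotZ θ x := mirrorV_eq_self hy1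
    have h1 : swirl u (rotZ θ x) = -swirl u (rotZ θ x) := by
      conv_lhs => rw [← hfix]
      exact swirl_mirrorV hmir _
    have h2 : swirl u (rotZ θ x) = 0 := by linarith
    rwa [swirl_rotZ hax] at h2

/-- Hence the LANDED no-swirl stratum decides every axisymmetric mirror-symmetric `L³` datum. -/
theorem hasGlobalKatoSolution_of_isAxisymmetric_of_isMirrorSymmetric {ν : ℝ} (hν : 0 < ν)
    {u₀ : EuclideanSpace ℝ (Fin 3) → EuclideanSpace ℝ (Fin 3)} (hL3 : MemLp u₀ 3 volume)
    (hdiv : IsWeaklyDivFree u₀) (hax : IsAxisymmetric u₀) (hmir : IsMirrorSymmetric u₀) :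
    HasGlobalKatoSolution ν u₀ :=
  NoSwirlStratum.axisymmetricKatoGlobal_noSwirl_stratum ν hν u₀ hL3 hdiv hax
    (hasNoSwirl_of_isAxisymmetric_of_isMirrorSymmetric hax hmir)

/-! ## §2 Route-level bypass (recommendation R1): AX_H leaves the cone -/

/-- R1a — crux #2 re-posed for the vertical-mirror groups `C_{p v}`: Clay failure at `ν` ⇒ for every
`N` there are `p ≥ max(N,2)` and an `Ḣ^{1/2}`-minimal blow-up datum equivariant under `R_{2π/p}`
AND under `σ_v`. (Smith theory needs it only for `p = 2^k`, where `C_{2^k v}` is a 2-group: the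
input is `F₂`-acyclicity + finitistic-ness of `M̂`, versus `F_p`-acyclicity for infinitely many
primes in the cyclic form. Same failure mode as `MinimalDatumPFold`: `M̂` may be a finite union
of non-acyclic orbits.) -/
def MinimalDatumMirrorPFold : Prop :=
  ∀ ν : ℝ, 0 < ν → (∃ v₀ : EuclideanSpace ℝ (Fin 3) → EuclideanSpace ℝ (Fin 3), ContDiff ℝ (⊤ : ℕ∞) v₀ ∧ Literature.Analysis.FluidPDE.NSWave0.IsDivFree v₀ ∧ Literature.Analysis.FluidPDE.HasRapidSpatialDecay v₀ ∧ ¬ ∃ (u : ℝ → EuclideanSpace ℝ (Fin 3) → EuclideanSpace ℝ (Fin 3)) (p : ℝ → EuclideanSpace ℝ (Fin 3) → ℝ), Literature.Analysis.FluidPDE.IsSmoothOnHalfSpace u ∧ Literature.Analysis.FluidPDE.IsSmoothOnHalfSpace p ∧ Literature.Analysis.FluidPDE.IsNavierStokesSolution ν 0 v₀ u p ∧ Literature.Analysis.FluidPDE.HasBoundedEnergy u) →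
    ∀ N : ℕ, ∃ p : ℕ, N ≤ p ∧ 2 ≤ p ∧
      ∃ (u₀ : EuclideanSpace ℝ (Fin 3) → EuclideanSpace ℝ (Fin 3))
        (g : Literature.Analysis.FunctionSpaces.HomSobolev (EuclideanSpace ℝ (Fin 3)) (EuclideanSpace ℂ (Fin 3)) (1 / 2 : ℝ)),
        IsMinimalBlowupDatum ν u₀ g ∧ (∀ x, u₀ (rotZ (2 * Real.pi / p) x) = rotZ (2 * Real.pi / p) (u₀ x)) ∧
          IsMirrorSymmetric u₀

/-- R1b — the compactness upgrade in mirror form (the cyclic form `PFoldToAxisymmetric` is PROVED,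
`Theorems.axisymmetricExtremality_pFoldToAxisymmetric_proof`; `σ_v`-equivariance is a closed
condition and the mirror plane contains the pinned axis, so the same modulation argument carries
it to the limit; WLOG plane `{x₁ = 0}` by rotation invariance of `M`). -/
def MirrorPFoldToAxisymmetric : Prop :=
  ∀ ν : ℝ, 0 < ν →
    (∀ N : ℕ, ∃ p : ℕ, N ≤ p ∧ 2 ≤ p ∧
      ∃ (u₀ : EuclideanSpace ℝ (Fin 3) → EuclideanSpace ℝ (Fin 3))
        (g : Literature.Analysis.FunctionSpaces.HomSobolev (EuclideanSpace ℝ (Fin 3)) (EuclideanSpace ℂ (Fin 3)) (1 / 2 : ℝ)),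
        IsMinimalBlowupDatum ν u₀ g ∧ (∀ x, u₀ (rotZ (2 * Real.pi / p) x) = rotZ (2 * Real.pi / p) (u₀ x)) ∧
          IsMirrorSymmetric u₀) →
    ∃ (u₀ : EuclideanSpace ℝ (Fin 3) → EuclideanSpace ℝ (Fin 3))
      (g : Literature.Analysis.FunctionSpaces.HomSobolev (EuclideanSpace ℝ (Fin 3)) (EuclideanSpace ℂ (Fin 3)) (1 / 2 : ℝ)),
      IsMinimalBlowupDatum ν u₀ g ∧ IsAxisymmetric u₀ ∧ IsMirrorSymmetric u₀

/-- **The re-glued deciding theorem needs no `AxisymmetricKatoGlobal`.** Pure logic + the landed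
no-swirl stratum + §1. -/
theorem closes_mirror (h₂ : MinimalDatumMirrorPFold) (h₄ : MirrorPFoldToAxisymmetric) :
    _root_.NavierStokesRegularity := by
  show Literature.NS.NavierStokesExistenceSmoothR3
  intro ν hν u₀ hsm hdiv hdec
  by_contra hno
  obtain ⟨u₁, g, hmin, hax, hmir⟩ := h₄ ν hν (h₂ ν hν ⟨u₀, hsm, hdiv, hdec, hno⟩)
  obtain ⟨hL3, -, hdiv₁, -, hnot⟩ := hmin
  exact hnot (hasGlobalKatoSolution_of_isAxisymmetric_of_isMirrorSymmetric hν hL3 hdiv₁ hax hmir)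

/-- Sanity: the mirror form of crux #2 implies the cyclic form (so R1a is a strengthening of the
route's rank-2 crux, not a new mechanism). -/
theorem minimalDatumPFold_of_mirror (h : MinimalDatumMirrorPFold) : MinimalDatumPFold := by
  intro ν hν hfail N
  obtain ⟨p, hNp, h2p, u₀, g, hmin, hrot, -⟩ := h ν hν hfail N
  exact ⟨p, hNp, h2p, u₀, g, hmin, fun x => hrot x⟩

/-! ## §3 W1 — the weakest replacement of the crux that keeps `closes` verbatim -/

/-- W1: there is no axisymmetric `Ḣ^{1/2}`-minimal blow-up datum (at any `ν > 0`). This is exactly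
what `closes` consumes of AX_H. -/
def NoAxisymMinimalBlowupDatum : Prop :=
  ∀ ν : ℝ, 0 < ν → ∀ (u₀ : EuclideanSpace ℝ (Fin 3) → EuclideanSpace ℝ (Fin 3))
    (g : Literature.Analysis.FunctionSpaces.HomSobolev (EuclideanSpace ℝ (Fin 3)) (EuclideanSpace ℂ (Fin 3)) (1 / 2 : ℝ)),
    IsMinimalBlowupDatum ν u₀ g → IsAxisymmetric u₀ → False

theorem W1_of_crux (h : AxisymmetricKatoGlobal) : NoAxisymMinimalBlowupDatum := by
  intro ν hν u₀ g hmin hax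
  obtain ⟨hL3, hrep, hdiv, -, hnot⟩ := hmin
  exact hnot (h ν hν u₀ g hL3 hrep hdiv (fun θ x => hax θ x))

theorem closes_of_W1 (h₂ : MinimalDatumPFold) (h₄ : PFoldToAxisymmetric)
    (hW : NoAxisymMinimalBlowupDatum) : _root_.NavierStokesRegularity := by
  show Literature.NS.NavierStokesExistenceSmoothR3
  intro ν hν u₀ hsm hdiv hdec
  by_contra hno
  obtain ⟨u₁, g, hmin, hax⟩ := h₄ ν hν (h₂ ν hν ⟨u₀, hsm, hdiv, hdec, hno⟩)
  exact hW ν hν u₁ g hmin (fun θ x => hax θ x)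

/-! ## §4 The only two-sided-open split found: the KNSS Liouville bridge (trivial seam) -/

/-- L1 — KNSS Liouville conjecture, axisymmetric class (KNSS 2009 p. 10: open; known with no swirl
= `KNSS2009_liouville_axisymmetric_no_swirl`, or under `r|u| ≤ C` = `KNSS2009_liouville_bound_C_over_r`):
every bounded weak NS solution on `ℝ³ × (−∞,0)` axisymmetric about the `x₂`-axis is a parasitic
`b(t) • e_z`. -/
def AxisymLiouville : Prop :=
  ∀ ⦃u : ℝ → EuclideanSpace ℝ (Fin 3) → EuclideanSpace ℝ (Fin 3)⦄,
    IsBoundedWeakNSSolutionOn (Iio 0) isOpen_Iio 1 u →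
    (∀ θ : ℝ, ∀ᵐ t ∂(volume.restrict (Iio (0 : ℝ))),
      (fun x => u t (rotZ θ x)) =ᵐ[volume] fun x => rotZ θ (u t x)) →
    ∃ b : ℝ → ℝ, Measurable b ∧ (∃ C : ℝ, ∀ t, |b t| ≤ C) ∧
      ∀ᵐ t ∂(volume.restrict (Iio (0 : ℝ))), u t =ᵐ[volume] fun _ => b t • eZ

/-- L2 — the bridge "Liouville ⇒ axisymmetric Kato regularity" (open: the sup-norm rescaling of a
Type II blow-up may converge to the constant jet `e_z`, which L1 allows; Type I is excluded
unconditionally, `knss_no_axisymmetric_typeI_holds`). -/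
def LiouvilleToKato : Prop := AxisymLiouville → AxisymmetricKatoGlobal

/-- The seam is modus ponens (flag `trivial_seam`); recorded so the census can say precisely why
this split is not filed: L2 has no plan (no normalisation is known to force a non-constant limit). -/
theorem crux_of_liouville_split (h₁ : AxisymLiouville) (h₂ : LiouvilleToKato) :
    AxisymmetricKatoGlobal := h₂ h₁

end Summit.NavierStokesRegularity.NavierStokesRegularity.Cruxes.AxisymmetricKatoGlobal.StrategistS17g5
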